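import Literature.Analysis.FluidPDE.CheskidovGluedEstimates
import Literature.Analysis.FluidPDE.CheskidovGluedCalculus
import HarnessLib

/-!
# Cheskidov's time-glued family: the limit drift `ṽ` and derivative bounds on the blocks
(arXiv:2311.04182, §3 (3.7), (3.9), (3.11); Thm. 3.1 (a))

Topic `Literature/Analysis/FluidPDE` (family `turb`; support file for the proof of
`Literature.Analysis.FluidPDE.cheskidov_noAnomaly_family` from its ingredients). This file BUILDS
ON the landed gluing of `CheskidovGluedFamily` / `CheskidovForces` / `CheskidovGluedEstimates`
(written for `cheskidov_total_dissipation_family`): the reparametrised blocks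
`Gluing.blockDrift`, `Gluing.blockProfile`, the glued families `Gluing.drift v m = v^m`,
`Gluing.profile ρ m = ρ^m`, the limit profile `Gluing.limProfile ρ = ρ̃`, the limit force
`Gluing.limForce v = g`, the hypothesis bundles `Gluing.Blocks` (transport + handover) and
`Gluing.BlockBounds` (sup-norm content of Thm. 3.1 (a)). It adds the two things the planar
no-anomaly family (the core of Cheskidov 2023, Thm. 2.1, `e = 0`) needs beyond them:

* `Gluing.limDrift v` — **the limit drift `ṽ` of (3.7)** (the Euler velocity `v` of §4 p. 12:
  `ṽ` on `[0,1)`, `0` on `[1,2]`), in the landed style: the moving block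
  `blockDrift v (blockIdx t)` for `t < 1`, `0` afterwards. API: `limDrift_eq_drift`
  (`ṽ = v^m` on `(-∞, tₘ₊₁)`, the analogue of `limProfile_eq_profile`), local structure
  (`limDrift_eventuallyEq_blockDrift/drift/zero`), smoothness on `(-∞,1) × T^d`, the time
  derivative (`hasDerivAt_limDrift`, from the landed `hasDerivAt_blockDrift`), divergence
  freedom, **the transport equation for the limit pair `(ṽ, ρ̃)` on `[0,1)`**
  (`isClassicalScalarTransportOn_lim`, (3.9), from the landed `deriv_profile_add_inner`),
  `g = ∂ₜṽ + (ṽ·∇)ṽ` on `[0,1)` with the one-sided time derivative of the solution convention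
  (`limForce_eq_timeDerivWithin_add_convect`, (3.11)), and eventual stationarity in the form of
  the statements (`drift_eq_limDrift_and_profile_eq_limProfile`);
* `Gluing.BlockDerivBounds v A` — `BlockBounds v A` **extended by the pointwise bounds on the
  spatial derivatives** `∂ᵢvₙ`, `∂ᵢ∂ⱼvₙ`, `∂ᵢ∂ⱼ∂ₗvₙ`, `∂ᵢ∂ₛvₙ` (Thm. 3.1 (a) at
  `(α,k) ∈ {(1,0),(2,0),(3,0),(1,1)}`) which the `C^α` force estimates of Bruè–De Lellis 2023,
  Lemma 5.1 consume (the landed `BlockBounds` suffices for `L²` forces only), with the extraction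
  `exists_blockDerivBounds` from the clauses of `alberti_crippa_mazzucato_family`
  (on top of the landed `exists_blockBounds`, via `eContDiffHolderNorm_partialDeriv_le` of
  `CheskidovGluedCalculus`).

Bookkeeping: `blockIdx_of_lt_tn_one` (generalises the landed `blockIdx_of_neg` to `t < t₁`),
`blockIdx_le_of_lt_tn_succ` (the inequality proved inline as `hjm` in the landed files),
`lt_one_cases`.

## References

* A. Cheskidov, *Dissipation anomaly and anomalous dissipation in incompressible fluid flows*,
  arXiv:2311.04182 (2023), Thm. 3.1 (a), (3.7), (3.9), (3.11), §4 p. 12.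
* E. Bruè, C. De Lellis, *Anomalous dissipation for the forced 3D Navier–Stokes equations*,
  Comm. Math. Phys. 400 (2023), Thm. 4.1 (a), §5 (5.1), Lemma 5.1.
-/

noncomputable section

open MeasureTheory Set Filter
open _root_.Topology
open scoped ENNReal NNReal ContDiff InnerProductSpace

namespace Literature.Analysis.FluidPDE.Gluing

open Literature.Analysis.FunctionSpaces

/-! ## More bookkeeping on the gluing times -/

/-- `t₁ = 1/2`. [folklore] -/
theorem tn_one : tn 1 = 1 / 2 := by norm_num [tn]

/-- `blockIdx t = 0` for `t < t₁ = 1/2`; this covers negative times as well and so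
generalises `blockIdx_of_neg`. [folklore] -/
theorem blockIdx_of_lt_tn_one {t : ℝ} (ht : t < tn 1) : blockIdx t = 0 := by
  rcases lt_or_ge t 0 with h0 | h0
  · exact blockIdx_of_neg h0
  · exact blockIdx_of_mem_Ico ⟨by rw [tn_zero]; exact h0, by simpa using ht⟩

/-- `t < tₘ₊₁ ⇒ blockIdx t ≤ m` (the inequality proved inline as `hjm` throughout
`CheskidovGluedFamily`). [folklore] -/
theorem blockIdx_le_of_lt_tn_succ {t : ℝ} {m : ℕ} (ht : t < tn (m + 1)) : blockIdx t ≤ m := by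
  rcases lt_or_ge t (tn 1) with h1 | h1
  · rw [blockIdx_of_lt_tn_one h1]; exact Nat.zero_le _
  have h0 : 0 ≤ t := le_trans (by rw [tn_one]; norm_num) h1
  have ht1 : t < 1 := ht.trans_le (tn_lt_one _).le
  have hmem := mem_Ico_tn_blockIdx h0 ht1
  have : tn (blockIdx t) < tn (m + 1) := hmem.1.trans_lt ht
  exact Nat.lt_succ_iff.1 (tn_strictMono.lt_iff_lt.1 this)

/-- Trichotomy for times `t < 1`: left of `t₁`, inside an open gluing interval, or at a gluing
time `tₙ₊₁`. [folklore] -/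
theorem lt_one_cases {t : ℝ} (ht : t < 1) :
    t < tn 1 ∨ (∃ n, t ∈ Ioo (tn n) (tn (n + 1))) ∨ ∃ n, t = tn (n + 1) := by
  rcases lt_or_ge t (tn 1) with h1 | h1
  · exact Or.inl h1
  have h0 : 0 ≤ t := le_trans (by rw [tn_one]; norm_num) h1
  obtain ⟨n, hn⟩ := exists_mem_Ico_tn h0 ht
  rcases hn.1.eq_or_lt with h | h
  · obtain ⟨k, rfl⟩ : ∃ k, n = k + 1 := by
      refine Nat.exists_eq_add_one_of_ne_zero ?_
      rintro rfl
      rw [tn_zero] at h; rw [← h, tn_one] at h1; norm_num at h1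
    exact Or.inr (Or.inr ⟨k, h.symm⟩)
  · exact Or.inr (Or.inl ⟨n, h, hn.2⟩)

/-! ## The limit drift `ṽ` (Cheskidov 2023, (3.7)) -/

variable {d : Type*} [Fintype d] [DecidableEq d]

/-- **Cheskidov's limit drift** `ṽ(t) = σₙ'(t) vₙ(σₙ(t))` for `t` in the `n`-th gluing interval,
`t < 1` (arXiv:2311.04182, (3.7); Bruè–De Lellis 2023, (5.1) with `m = ∞`), extended by zero from
the blow-up time `t = 1` on (as the Euler velocity `v` of §4, p. 12: "`v(t) = ṽ(t)` for
`t ∈ [0,1)`, `0` for `t ∈ [1,2]`"); in the landed style of `limProfile`/`limForce`: the moving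
block is `blockDrift v (blockIdx t)`. It agrees with every glued drift `drift v m` on
`(-∞, tₘ₊₁)` (`limDrift_eq_drift`). For `t < 0` it vanishes since `blockDrift v 0` does.
[cite: Cheskidov2023, §3 (3.7)] -/
def limDrift (v : ℕ → ℝ → UnitAddTorus d → EuclideanSpace ℝ d) (t : ℝ) (x : UnitAddTorus d) :
    EuclideanSpace ℝ d :=
  if t < 1 then blockDrift v (blockIdx t) t x else 0

section LimDrift

variable {v : ℕ → ℝ → UnitAddTorus d → EuclideanSpace ℝ d} {ρ : ℕ → ℝ → UnitAddTorus d → ℝ}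
  {m n : ℕ} {t : ℝ}

omit [Fintype d] [DecidableEq d] in
/-- In the `n`-th gluing interval the limit drift is the `n`-th block drift. [cite: Cheskidov2023, §3 (3.7)] -/
theorem limDrift_of_mem_Ico (ht : t ∈ Ico (tn n) (tn (n + 1))) : limDrift v t = blockDrift v n t := by
  funext x
  simp only [limDrift, if_pos (ht.2.trans_le (tn_lt_one _).le), blockIdx_of_mem_Ico ht]

omit [Fintype d] [DecidableEq d] in
/-- Left of `t₁` (including negative times) the limit drift is the `0`-th block drift. [folklore] -/
theorem limDrift_of_lt_tn_one (ht : t < tn 1) : limDrift v t = blockDrift v 0 t := by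
  funext x
  simp only [limDrift, if_pos (ht.trans (tn_lt_one 1)), blockIdx_of_lt_tn_one ht]

omit [Fintype d] [DecidableEq d] in
/-- From the blow-up time on the limit drift is zero (Cheskidov 2023, §4 p. 12). [cite: Cheskidov2023, §4 p. 12] -/
theorem limDrift_of_one_le (ht : 1 ≤ t) : limDrift v t = 0 := by
  funext x; simp [limDrift, not_lt.2 ht]

omit [Fintype d] [DecidableEq d] in
/-- For `t ≤ 0` the limit drift is zero (block `0` is at rest up to `t₀ = 0`). [folklore] -/
theorem limDrift_of_nonpos (ht : t ≤ 0) : limDrift v t = 0 := by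
  rw [limDrift_of_lt_tn_one (lt_of_le_of_lt ht (by rw [tn_one]; norm_num)),
    blockDrift_eq_zero_of_le v (by rwa [tn_zero])]

omit [Fintype d] [DecidableEq d] in
/-- The limit drift vanishes outside `(0,1)`. [cite: Cheskidov2023, §4 p. 12] -/
theorem limDrift_of_not_mem_Ioo (ht : t ∉ Ioo (0 : ℝ) 1) : limDrift v t = 0 := by
  rcases le_or_gt t 0 with h | h
  · exact limDrift_of_nonpos h
  · exact limDrift_of_one_le (not_lt.1 fun h1 => ht ⟨h, h1⟩)

omit [Fintype d] [DecidableEq d] in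
/-- **`ṽ = v^m` before `tₘ₊₁`** (Cheskidov 2023, (3.4) versus (3.7): the sums agree as long as
`η(t) < tₘ₊₁`; the analogue of `limProfile_eq_profile`). [cite: Cheskidov2023, §3 (3.7)] -/
theorem limDrift_eq_drift (ht : t < tn (m + 1)) : limDrift v t = drift v m t := by
  rcases lt_or_ge t 0 with h0 | h0
  · rw [limDrift_of_nonpos h0.le, drift_eq_zero_of_nonpos v h0.le]
  · have hmem := mem_Ico_tn_blockIdx h0 (ht.trans_le (tn_lt_one _).le)
    rw [limDrift_of_mem_Ico hmem, drift_eq_blockDrift v (blockIdx_le_of_lt_tn_succ ht) hmem]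

omit [Fintype d] [DecidableEq d] in
/-- Near a time of the `n`-th gluing interval (or left of `t₁` for `n = 0`) the limit drift IS
the `n`-th block drift: inside the open interval trivially, and at the gluing time `tₙ`, `n ≥ 1`,
because both the previous and the present block drift vanish near `tₙ`. [folklore] -/
theorem limDrift_eventuallyEq_blockDrift (ht : t ∈ Ico (tn n) (tn (n + 1)) ∨ (n = 0 ∧ t < tn 1)) :
    limDrift v =ᶠ[𝓝 t] blockDrift v n := by
  rcases ht with ht | ⟨rfl, ht⟩
  · rcases ht.1.eq_or_lt with h | h
    · -- `t = tn n`
      rcases n with - | k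
      · filter_upwards [Iio_mem_nhds (show t < tn 1 by rw [← h]; exact tn_lt_tn_succ 0)] with τ hτ
          using limDrift_of_lt_tn_one hτ
      · have hlo : tn k + 2 * tau k / 3 < t := by rw [← h, tn_succ]; linarith [tau_pos k]
        filter_upwards [Ioo_mem_nhds hlo ht.2] with τ hτ
        rcases lt_or_ge τ (tn (k + 1)) with h1 | h1
        · rw [limDrift_of_mem_Ico ⟨by linarith [tau_pos k, hτ.1], h1⟩,
            blockDrift_eq_zero_of_le v h1.le]
          funext x
          rw [blockDrift, deriv_sigma_eq_zero_of_ge hτ.1.le, zero_smul]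
          rfl
        · exact limDrift_of_mem_Ico ⟨h1, hτ.2⟩
    · filter_upwards [Ioo_mem_nhds h ht.2] with τ hτ using limDrift_of_mem_Ico ⟨hτ.1.le, hτ.2⟩
  · filter_upwards [Iio_mem_nhds ht] with τ hτ using limDrift_of_lt_tn_one hτ

omit [Fintype d] [DecidableEq d] in
/-- Before `tₘ₊₁` the limit drift is eventually (in time) the glued drift `v^m`. [folklore] -/
theorem limDrift_eventuallyEq_drift (ht : t < tn (m + 1)) : limDrift v =ᶠ[𝓝 t] drift v m := by
  filter_upwards [Iio_mem_nhds ht] with τ hτ using limDrift_eq_drift hτ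

omit [Fintype d] [DecidableEq d] in
/-- Past the blow-up time the limit drift is eventually zero. [folklore] -/
theorem limDrift_eventuallyEq_zero (ht : 1 < t) : limDrift v =ᶠ[𝓝 t] fun _ _ => 0 := by
  filter_upwards [Ioi_mem_nhds ht] with τ hτ
  rw [limDrift_of_one_le hτ.le]; rfl

/-- **`ṽ` is smooth on `(-∞, 1) × T^d`** (locally it is one of the smooth `v^m`; Cheskidov 2023,
p. 10: `ṽ ∈ C^∞([0,1) × T²)`). [cite: Cheskidov2023, §3 (3.7)] -/
theorem isSmoothSpaceTimeOn_limDrift (hB : Blocks ρ v) :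
    Torus.IsSmoothSpaceTimeOn (Iio 1) (limDrift v) := by
  refine contDiffOn_of_locally_contDiffOn fun p hp => ?_
  obtain ⟨t, y⟩ := p
  have ht : t < 1 := (mem_prod.1 hp).1
  obtain ⟨m, hm⟩ : ∃ m : ℕ, t < tn (m + 1) :=
    ((tendsto_tn.comp (tendsto_add_atTop_nat 1)).eventually (Ioi_mem_nhds ht)).exists
  refine ⟨Iio (tn (m + 1)) ×ˢ univ, isOpen_Iio.prod isOpen_univ, mk_mem_prod hm (mem_univ _), ?_⟩
  have hdrift : ContDiffOn ℝ ∞ (Torus.stLift (drift v m))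
      (Iio (1 : ℝ) ×ˢ (univ : Set (EuclideanSpace ℝ d)) ∩ Iio (tn (m + 1)) ×ˢ univ) :=
    ContDiffOn.mono (isSmoothSpaceTimeOn_drift hB m) fun q _ => mk_mem_prod (mem_univ _) (mem_univ _)
  refine hdrift.congr fun q hq => ?_
  obtain ⟨s, z⟩ := q
  have hs : s < tn (m + 1) := (mem_prod.1 (inter_subset_right hq)).1
  simp only [Torus.stLift_apply]
  rw [limDrift_eq_drift hs]

omit [DecidableEq d] in
/-- **Time derivative of the limit drift** at a time of the `n`-th gluing interval (or left of
`t₁` for `n = 0`): `∂ₜṽ(t) = σₙ''(t) vₙ(σₙ(t)) + σₙ'(t)² ∂ₛvₙ(σₙ(t))` (from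
`hasDerivAt_blockDrift`; two-sided in `t`). [cite: Cheskidov2023, §3 (3.7)] -/
theorem hasDerivAt_limDrift (hv : Torus.IsSmoothSpaceTimeOn (Icc 0 1) (v n))
    (ht : t ∈ Ico (tn n) (tn (n + 1)) ∨ (n = 0 ∧ t < tn 1)) (x : UnitAddTorus d) :
    HasDerivAt (fun τ => limDrift v τ x)
      (deriv (deriv (sigma n)) t • v n (sigma n t) x +
        deriv (sigma n) t • (deriv (sigma n) t • Torus.timeDerivWithin (Icc 0 1) (v n) (sigma n t) x)) t :=
  (hasDerivAt_blockDrift hv t x).congr_of_eventuallyEq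
    ((limDrift_eventuallyEq_blockDrift ht).mono fun τ hτ => by
      show limDrift v τ x = blockDrift v n τ x
      rw [hτ])

omit [DecidableEq d] in
/-- The limit drift is differentiable in time everywhere except possibly at the blow-up time. [folklore] -/
theorem differentiableAt_limDrift (hv : ∀ n, Torus.IsSmoothSpaceTimeOn (Icc 0 1) (v n)) (ht : t ≠ 1)
    (x : UnitAddTorus d) : DifferentiableAt ℝ (fun τ => limDrift v τ x) t := by
  rcases lt_or_gt_of_ne ht with h | h
  · rcases lt_or_ge t 0 with h0 | h0
    · exact (hasDerivAt_limDrift (hv 0) (Or.inr ⟨rfl, h0.trans (by rw [tn_one]; norm_num)⟩) x).differentiableAt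
    · exact (hasDerivAt_limDrift (hv _) (Or.inl (mem_Ico_tn_blockIdx h0 h)) x).differentiableAt
  · exact (differentiableAt_const (0 : EuclideanSpace ℝ d)).congr_of_eventuallyEq
      ((limDrift_eventuallyEq_zero h).mono fun τ hτ => by
        show limDrift v τ x = 0
        rw [hτ])

omit [DecidableEq d] in
/-- **The one-sided time derivative of `ṽ` within `[0,1)`** is the two-sided one and equals the
time derivative of the moving block drift. [cite: Cheskidov2023, §3 (3.7)] -/
theorem timeDerivWithin_limDrift (hv : ∀ n, Torus.IsSmoothSpaceTimeOn (Icc 0 1) (v n))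
    (ht : t ∈ Ico (0 : ℝ) 1) (x : UnitAddTorus d) :
    Torus.timeDerivWithin (Ico 0 1) (limDrift v) t x =
      Torus.timeDerivWithin univ (blockDrift v (blockIdx t)) t x := by
  rw [timeDerivWithin_blockDrift (hv _)]
  exact (hasDerivAt_limDrift (hv _) (Or.inl (mem_Ico_tn_blockIdx ht.1 ht.2)) x).hasDerivWithinAt.derivWithin
    (uniqueDiffOn_Ico 0 1 t ht)

/-- The limit drift is divergence free at every time. [cite: Cheskidov2023, §3 (3.7)] -/
theorem isDivFree_limDrift (hB : Blocks ρ v) (t : ℝ) : Torus.IsDivFree (limDrift v t) := by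
  rcases lt_or_ge t 1 with h | h
  · obtain ⟨m, hm⟩ : ∃ m : ℕ, t < tn (m + 1) :=
      ((tendsto_tn.comp (tendsto_add_atTop_nat 1)).eventually (Ioi_mem_nhds h)).exists
    rw [limDrift_eq_drift hm]
    exact isDivFree_drift hB m t
  · rw [limDrift_of_one_le h]
    intro x; simp [Torus.divergence, Torus.partialDeriv, Torus.lineDeriv]

/-- **The limit force is `∂ₜṽ + (ṽ·∇)ṽ` on `[0,1)`** with the one-sided time derivative of the
solution convention (Cheskidov 2023, (3.11): `g := ∂ₜṽ + (ṽ·∇)ṽ`). [cite: Cheskidov2023, §3 (3.11)] -/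
theorem limForce_eq_timeDerivWithin_add_convect (hB : Blocks ρ v) (ht : t ∈ Ico (0 : ℝ) 1)
    (x : UnitAddTorus d) :
    limForce v t x = Torus.timeDerivWithin (Ico 0 1) (limDrift v) t x +
      Torus.convect (limDrift v t) (limDrift v t) x := by
  have hmem := mem_Ico_tn_blockIdx ht.1 ht.2
  rw [timeDerivWithin_limDrift (fun n => (hB.sol n).smooth_velocity) ht, limDrift_of_mem_Ico hmem, limForce,
    if_pos ⟨ht.1, ht.2⟩, blockForce, timeDerivWithin_blockDrift (hB.sol _).smooth_velocity]

/-- **The limit pair `(ṽ, ρ̃)` is a classical solution of the transport equation on `[0,1)`**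
(Cheskidov 2023, (3.9): "`ρ̃` is a smooth solution to the transport equation on `[0,1)`"): near
every `t < tₘ₊₁` it is the glued pair `(v^m, ρ^m)`, which solves the equation on all of `ℝ`
(`deriv_profile_add_inner`). [cite: Cheskidov2023, §3 (3.9)] -/
theorem isClassicalScalarTransportOn_lim (hB : Blocks ρ v) :
    Torus.IsClassicalScalarTransportOn (Ico 0 1) 0 (limDrift v) (limProfile ρ) where
  smooth_velocity := (isSmoothSpaceTimeOn_limDrift hB).mono Ico_subset_Iio_self
  smooth_scalar := (isSmoothSpaceTimeOn_limProfile hB).mono Ico_subset_Iio_self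
  transport t ht x := by
    set m := blockIdx t
    have htm : t < tn (m + 1) := (mem_Ico_tn_blockIdx ht.1 ht.2).2
    -- near `t` the limit pair is the glued pair `(v^m, ρ^m)`
    have hprof : (fun s => limProfile ρ s x) =ᶠ[𝓝 t] fun s => profile ρ m s x := by
      filter_upwards [Iio_mem_nhds htm] with s hs
      rw [limProfile_eq_profile hB hs]
    have hd : HasDerivAt (fun s => profile ρ m s x) (deriv (fun s => profile ρ m s x) t) t :=
      (((isSmoothSpaceTimeOn_profile hB m).hasDerivWithinAt_slice (mem_univ t) x).hasDerivAt
        univ_mem).differentiableAt.hasDerivAt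
    rw [Torus.timeDerivWithin, ((hd.congr_of_eventuallyEq hprof).hasDerivWithinAt).derivWithin
      (uniqueDiffOn_Ico 0 1 t ht), limDrift_eq_drift htm, limProfile_eq_profile hB htm, zero_mul]
    exact deriv_profile_add_inner hB m t x
  divFree t _ := isDivFree_limDrift hB t

/-- **Eventual stationarity** in the form of the statements: on `[0,T]`, `T < 1`, the glued pair
`(v^m, ρ^m)` is the limit pair as soon as `m ≥ blockIdx T` (Cheskidov 2023, (3.4)–(3.5) versus
(3.7)–(3.8)). [cite: Cheskidov2023, §3 (3.7)–(3.8)] -/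
theorem drift_eq_limDrift_and_profile_eq_limProfile (hB : Blocks ρ v) {T : ℝ} (hT : T ∈ Ico (0 : ℝ) 1)
    (hm : blockIdx T ≤ m) (ht : t ≤ T) : drift v m t = limDrift v t ∧ profile ρ m t = limProfile ρ t := by
  have h1 : T < tn (blockIdx T + 1) := (mem_Ico_tn_blockIdx hT.1 hT.2).2
  have h2 : t < tn (m + 1) := (ht.trans_lt h1).trans_le (tn_mono (Nat.succ_le_succ hm))
  exact ⟨(limDrift_eq_drift h2).symm, (limProfile_eq_profile hB h2).symm⟩

end LimDrift

/-! ## Derivative bounds on the building blocks (complement of `BlockBounds`) -/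

section DerivBounds

variable {v : ℕ → ℝ → UnitAddTorus d → EuclideanSpace ℝ d} {A A' : ℝ}

/-- **Block bounds with derivatives**: `BlockBounds v A` (sup norms of `vₙ`, `∂ₛvₙ`, `Δvₙ`,
`(vₙ·∇)vₙ`; `CheskidovForces`) extended by the pointwise bounds on the SPATIAL DERIVATIVES that
the `C^α` force estimates need — `‖∂ᵢvₙ(s)‖_∞ ≤ A`, `‖∂ᵢ∂ⱼvₙ(s)‖_∞ ≤ Aλₙ`,
`‖∂ᵢ∂ⱼ∂ₗvₙ(s)‖_∞ ≤ Aλₙ²`, `‖∂ᵢ∂ₛvₙ(s)‖_∞ ≤ A` for `s ∈ [0,1]`, `λₙ = 5ⁿ` — i.e. Cheskidov 2023,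
Thm. 3.1 (a) (Bruè–De Lellis 2023, Thm. 4.1 (a)) `‖∂ₜᵏvₙ‖_{L^∞C^α} ≤ C(α,k)λₙ^{α-1}` read at
`(α,k) ∈ {(1,0),(2,0),(3,0),(1,1)}` on top of the `(0,0),(0,1),(2,0)` content of `BlockBounds`.
An instance with one common constant is extracted from
`alberti_crippa_mazzucato_family` by `exists_blockDerivBounds`. [cite: Cheskidov2023, Thm. 3.1 (a)] -/
structure BlockDerivBounds (v : ℕ → ℝ → UnitAddTorus d → EuclideanSpace ℝ d) (A : ℝ) : Prop
    extends BlockBounds v A where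
  /-- `‖∂ᵢvₙ(s)‖_∞ ≤ A`. -/
  partialDeriv_le : ∀ n, ∀ s ∈ Icc (0 : ℝ) 1, ∀ x i, ‖Torus.partialDeriv i (v n s) x‖ ≤ A
  /-- `‖∂ᵢ∂ⱼvₙ(s)‖_∞ ≤ A 5ⁿ`. -/
  partialDeriv_two_le : ∀ n, ∀ s ∈ Icc (0 : ℝ) 1, ∀ x i j,
    ‖Torus.partialDeriv i (Torus.partialDeriv j (v n s)) x‖ ≤ A * 5 ^ n
  /-- `‖∂ᵢ∂ⱼ∂ₗvₙ(s)‖_∞ ≤ A 25ⁿ`. -/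
  partialDeriv_three_le : ∀ n, ∀ s ∈ Icc (0 : ℝ) 1, ∀ x i j l,
    ‖Torus.partialDeriv i (Torus.partialDeriv j (Torus.partialDeriv l (v n s))) x‖ ≤ A * 25 ^ n
  /-- `‖∂ᵢ∂ₛvₙ(s)‖_∞ ≤ A`. -/
  partialDeriv_timeDeriv_le : ∀ n, ∀ s ∈ Icc (0 : ℝ) 1, ∀ x i,
    ‖Torus.partialDeriv i (Torus.timeDerivWithin (Icc 0 1) (v n) s) x‖ ≤ A

omit [DecidableEq d] in
/-- Block bounds are monotone in the constant. [folklore] -/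
theorem BlockBounds.mono [DecidableEq d] (h : BlockBounds v A) (hAA' : A ≤ A') : BlockBounds v A' where
  nonneg := h.nonneg.trans hAA'
  sup_le n s hs x := (h.sup_le n s hs x).trans (div_le_div_of_nonneg_right hAA' (by positivity))
  timeDeriv_le n s hs x := (h.timeDeriv_le n s hs x).trans (div_le_div_of_nonneg_right hAA' (by positivity))
  laplacian_le n s hs x := (h.laplacian_le n s hs x).trans (mul_le_mul_of_nonneg_right hAA' (by positivity))
  convect_le n s hs x := (h.convect_le n s hs x).trans (div_le_div_of_nonneg_right hAA' (by positivity))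

/-- **Derivative block bounds from the Hölder bounds of the building blocks** (Cheskidov 2023,
Thm. 3.1 (a) with `r = 0`, `(j,k) ∈ {(1,0),(2,0),(3,0),(1,1)}`, read pointwise through
`eContDiffHolderNorm_partialDeriv_le`, on top of `exists_blockBounds`). [cite: Cheskidov2023, Thm. 3.1 (a)] -/
theorem exists_blockDerivBounds (hv : ∀ n, Torus.IsSmoothSpaceTimeOn (Icc 0 1) (v n))
    (ha : ∀ (j k : ℕ) (r : ℝ≥0), r < 1 → ∃ C : ℝ, ∀ n : ℕ, ∀ t ∈ Icc (0 : ℝ) 1,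
      Torus.eContDiffHolderNorm j r
          (fun x => iteratedDerivWithin k (fun s => v n s x) (Icc 0 1) t) ≤
        ENNReal.ofReal (C * (5 : ℝ) ^ (((j : ℝ) + r - 1) * n)))
    (ha' : ∀ (j k : ℕ) (r : ℝ≥0), r < 1 → 0 < (j : ℝ) + r → ∃ C : ℝ, ∀ n : ℕ, ∀ t ∈ Icc (0 : ℝ) 1,
      Torus.eContDiffHolderNorm j r
          (fun x => iteratedDerivWithin k
            (fun s => Torus.convect (v n s) (v n s) x) (Icc 0 1) t) ≤
        ENNReal.ofReal (C * (5 : ℝ) ^ (((j : ℝ) + r - 1) * n))) :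
    ∃ A : ℝ, BlockDerivBounds v A := by
  obtain ⟨A₀, hA₀⟩ := exists_blockBounds ha ha'
  obtain ⟨C10, h10⟩ := ha 1 0 0 zero_lt_one
  obtain ⟨C20, h20⟩ := ha 2 0 0 zero_lt_one
  obtain ⟨C30, h30⟩ := ha 3 0 0 zero_lt_one
  obtain ⟨C11, h11⟩ := ha 1 1 0 zero_lt_one
  set A : ℝ := max (max (max A₀ C10) (max C20 C30)) (max C11 0) with hA
  have hA0 : 0 ≤ A := le_max_of_le_right (le_max_right _ _)
  have kA₀ : A₀ ≤ A := by simp [hA]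
  have k10 : max C10 0 ≤ A := max_le (by simp [hA]) hA0
  have k20 : max C20 0 ≤ A := max_le (by simp [hA]) hA0
  have k30 : max C30 0 ≤ A := max_le (by simp [hA]) hA0
  have k11 : max C11 0 ≤ A := max_le (by simp [hA]) hA0
  have hvs : ∀ n, ∀ s ∈ Icc (0 : ℝ) 1, Torus.IsSmooth (v n s) := fun n s hs => (hv n).isSmooth_slice hs
  have hvts : ∀ n, ∀ s ∈ Icc (0 : ℝ) 1, Torus.IsSmooth (Torus.timeDerivWithin (Icc 0 1) (v n) s) :=
    fun n s hs => (hv n).isSmooth_timeDerivWithin (uniqueDiffOn_Icc zero_lt_one) hs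
  have e0 : ∀ n s, (fun x => iteratedDerivWithin 0 (fun s => v n s x) (Icc 0 1) s) = v n s := fun n s => by
    funext x; simp
  have e1 : ∀ n s, (fun x => iteratedDerivWithin 1 (fun s => v n s x) (Icc 0 1) s) =
      Torus.timeDerivWithin (Icc 0 1) (v n) s := fun n s => by
    funext x; simp [Torus.timeDerivWithin]
  have p1 : ∀ n : ℕ, (5 : ℝ) ^ ((((1 : ℕ) : ℝ) + ((0 : ℝ≥0) : ℝ) - 1) * n) = 1 := fun n => by simp
  have p2 : ∀ n : ℕ, (5 : ℝ) ^ ((((2 : ℕ) : ℝ) + ((0 : ℝ≥0) : ℝ) - 1) * n) = 5 ^ n := fun n => by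
    norm_num [Real.rpow_natCast]
  have p3 : ∀ n : ℕ, (5 : ℝ) ^ ((((3 : ℕ) : ℝ) + ((0 : ℝ≥0) : ℝ) - 1) * n) = 25 ^ n := fun n => by
    norm_num
    rw [show (2 : ℝ) * n = ((2 * n : ℕ) : ℝ) by push_cast; ring, Real.rpow_natCast, pow_mul]; norm_num
  have step : ∀ {c a y : ℝ}, max c 0 ≤ A → 0 ≤ a → y ≤ max (c * a) 0 → y ≤ A * a := by
    intro c a y hc ha hy
    refine hy.trans ?_
    rcases le_or_gt 0 c with h | h
    · rw [max_eq_left (mul_nonneg h ha)]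
      exact mul_le_mul_of_nonneg_right ((le_max_left _ _).trans hc) ha
    · rw [max_eq_right (mul_nonpos_iff.2 (Or.inr ⟨h.le, ha⟩))]
      exact mul_nonneg hA0 ha
  refine ⟨A, hA₀.mono kA₀, fun n s hs x i => ?_, fun n s hs x i j => ?_, fun n s hs x i j l => ?_,
    fun n s hs x i => ?_⟩
  · have h := h10 n s hs; rw [e0, p1] at h
    have := step k10 zero_le_one (norm_partialDeriv_le_of_eContDiffHolderNorm_one_le (hvs n s hs) h i x)
    rwa [mul_one] at this
  · have h := h20 n s hs; rw [e0, p2] at h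
    exact step k20 (by positivity)
      (norm_partialDeriv_partialDeriv_le_of_eContDiffHolderNorm_two_le (hvs n s hs) h i j x)
  · have h := h30 n s hs; rw [e0, p3] at h
    exact step k30 (by positivity)
      (norm_partialDeriv_partialDeriv_partialDeriv_le_of_eContDiffHolderNorm_three_le (hvs n s hs) h i j l x)
  · have h := h11 n s hs; rw [e1, p1] at h
    have := step k11 zero_le_one (norm_partialDeriv_le_of_eContDiffHolderNorm_one_le (hvts n s hs) h i x)
    rwa [mul_one] at this

end DerivBounds

end Literature.Analysis.FluidPDE.Gluing

end
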